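import Summits.RiemannHypothesis.RiemannHypothesis.Theses.RuelleBand
import Literature.NumberTheory.LFunctions.RiemannXiProofs

/-!
# `CofiniteCriticalLine` (crux stmt-RiemannHypothesis-2064): the collar statements of idea `rate-band-collar-split`, pointwise and at degenerate parameters

Companion of `HorizontalMonotonicity.lean` / `CollarCostume.lean` (crux ⟺ cofinite horizontal monotonicity of `|ξ|`;
the near half `CollarMono(η)` is implied by the crux at every rate). Refuter's standing-adversary output (cdisprove
cycle 2), kernel-checked, statements inline (the idea's bodies restated verbatim), no new definitions.

* `not_monotoneOn_collar_at_offLine_zero` — the near half's ENTIRE zero-side content, pointwise: at the ordinate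
  `γ₀` of an off-line zero `β₀ + iγ₀`, `β₀ > 1/2`, monotonicity of `x ↦ |ξ(1/2 + x + iγ₀)|` fails on every collar
  `[0, w]` with `w ≥ β₀ − 1/2` (a monotone `|ξ|` vanishing at `β₀ − 1/2` vanishes on `[0, β₀ − 1/2]`; zeros of the
  entire `ξ` are isolated, `ξ(0) = 1/2`). So `CollarMono(η)` at height `γ₀` implies "no off-line zero at height
  `γ₀` within `η(γ₀)` of the line" and is implied by "no off-line zero at heights within `1/2` of `γ₀`"
  (`strictMonoOn_norm_riemannXi_of_offLine_height`, `CollarCostume.lean`): nothing about `ξ` beyond the location of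
  its zeros enters the near half.
* `rateBand_of_neg_exponent` — `RateBand ε C T` with `ε < 0`, `C > 0` holds UNCONDITIONALLY above some height
  (the band `C|t|^{-ε}` widens past `1/2`); with `not_rateBand_of_neg` (`C < 0`: false) and `rateBand_zero_iff_cofinite`
  (`C = 0`: the whole crux) of `CollarCostume.lean`, the far half carries content only for `ε ≥ 0`, `C > 0`.
* `collarMono_of_nonpos` — `CollarMono ε C T₂` with `C ≤ 0` is vacuous (the collar is at most the point `0`).
-/

noncomputable section

open Complex Set Filter Topology
open scoped ComplexConjugate

namespace Summit.RiemannHypothesis.Cruxes.CofiniteCriticalLine.Negative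

open Summit.RiemannHypothesis.RiemannHypothesis.Theses.RuelleBand
open Literature.NumberTheory.LFunctions

/-- THE NEAR HALF'S ENTIRE ZERO-SIDE CONTENT, pointwise: at the ordinate `γ₀` of an off-line zero
`ρ₀ = β₀ + iγ₀` with `β₀ > 1/2`, monotonicity of `x ↦ |ξ(1/2 + x + iγ₀)|` FAILS on every collar `[0, w]` with
`w ≥ β₀ − 1/2` (a monotone `|ξ|` vanishing at `β₀ − 1/2` would vanish on `[0, β₀ − 1/2]`, and zeros of the entire
`ξ` are isolated, `ξ(0) = 1/2`). So `CollarMono(η)` at height `γ₀` IMPLIES "no off-line zero at height `γ₀`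
within `η(γ₀)` of the line", and is implied by "no off-line zero at any height within `1/2` of `γ₀`"
(`strictMonoOn_norm_riemannXi_of_offLine_height`): nothing about `ξ` beyond the location of its zeros enters.
[folklore] -/
theorem not_monotoneOn_collar_at_offLine_zero {ρ : ℂ} (hz : riemannZeta ρ = 0) (hρ : 1 / 2 < ρ.re)
    (h1 : ρ.re < 1) {w : ℝ} (hw : ρ.re - 1 / 2 ≤ w) :
    ¬ MonotoneOn (fun x : ℝ => ‖riemannXi (1 / 2 + x + ρ.im * Complex.I)‖) (Set.Icc 0 w) := by
  intro hmono
  have hξ : riemannXi ρ = 0 := (riemannXi_eq_zero_iff_holds ρ).2 ⟨hz, by linarith, h1⟩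
  set a : ℝ := ρ.re - 1 / 2 with ha
  have ha0 : 0 < a := by rw [ha]; linarith
  have hρa : (1 / 2 + (a : ℂ) + ρ.im * I : ℂ) = ρ := by apply Complex.ext <;> simp [ha]
  -- `|ξ|` vanishes on the segment `[1/2, re ρ] + i·im ρ`
  have hzero : ∀ x : ℝ, 0 ≤ x → x ≤ a → riemannXi (1 / 2 + x + ρ.im * I) = 0 := by
    intro x hx hxa
    have hle := hmono ⟨hx, le_trans hxa hw⟩ ⟨ha0.le, hw⟩ hxa
    simp only [hρa, hξ, norm_zero] at hle
    exact norm_eq_zero.1 (le_antisymm hle (norm_nonneg _))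
  -- isolated zeros of the entire, not identically zero `ξ`
  have han : AnalyticAt ℂ riemannXi ρ := differentiable_riemannXi.analyticAt ρ
  rcases han.eventually_eq_zero_or_eventually_ne_zero with hev | hev
  · have hall := AnalyticOnNhd.eqOn_zero_of_preconnected_of_eventuallyEq_zero
      (fun z _ => differentiable_riemannXi.analyticAt z) isPreconnected_univ (mem_univ ρ) hev
    have h00 := hall (mem_univ (0 : ℂ))
    rw [riemannXi_zero] at h00
    norm_num at h00
  · rw [eventually_nhdsWithin_iff, Metric.eventually_nhds_iff] at hev
    obtain ⟨δ, hδ, hδ'⟩ := hev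
    set m : ℝ := min (δ / 2) (a / 2) with hm
    have hm0 : 0 < m := lt_min (by linarith) (by linarith)
    have hz' := hzero (a - m) (by linarith [min_le_right (δ / 2) (a / 2)]) (by linarith)
    have hpt : (1 / 2 + ((a - m : ℝ) : ℂ) + ρ.im * I : ℂ) = ρ - m := by
      apply Complex.ext
      · simp [ha]; ring
      · simp
    rw [hpt] at hz'
    refine hδ' (y := ρ - m) ?_ ?_ hz'
    · rw [dist_eq_norm, sub_sub_cancel_left, norm_neg, Complex.norm_real, Real.norm_eq_abs, abs_of_pos hm0]
      linarith [min_le_left (δ / 2) (a / 2)]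
    · rw [mem_compl_singleton_iff, Ne, sub_eq_self]
      exact_mod_cast hm0.ne'

/-- `RateBand ε C T` with a NEGATIVE exponent `ε < 0` (the "band" `C|t|^{-ε}` widens) and `C > 0` holds
unconditionally above some height (`|β − 1/2| < 1/2 ≤ C|t|^{|ε|}`): the exponent must be `≥ 0` for the far half
to say anything. [folklore] -/
theorem rateBand_of_neg_exponent {ε C : ℝ} (hε : ε < 0) (hC : 0 < C) :
    ∃ T : ℝ, ∀ s : ℂ, riemannZeta s = 0 → 0 < s.re → s.re < 1 → T ≤ |s.im| →
      |s.re - 1 / 2| ≤ C * |s.im| ^ (-ε) := by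
  set T₀ : ℝ := (1 / (2 * C)) ^ (1 / (-ε)) with hT₀
  have hT₀nn : 0 ≤ T₀ := Real.rpow_nonneg (by positivity) _
  have hT₀pow : T₀ ^ (-ε) = 1 / (2 * C) := by
    rw [hT₀, one_div (-ε)]
    exact Real.rpow_inv_rpow (by positivity) (by linarith)
  refine ⟨T₀, fun s _ h0 h1 hs => ?_⟩
  have hpow : 1 / (2 * C) ≤ |s.im| ^ (-ε) := by
    rw [← hT₀pow]
    exact Real.rpow_le_rpow hT₀nn hs (by linarith)
  have hlt : |s.re - 1 / 2| ≤ 1 / 2 := by rw [abs_le]; constructor <;> linarith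
  calc |s.re - 1 / 2| ≤ 1 / 2 := hlt
    _ = C * (1 / (2 * C)) := by field_simp
    _ ≤ C * |s.im| ^ (-ε) := by gcongr

/-- `CollarMono ε C T₂` with `C ≤ 0` is VACUOUS (the collar `[0, C|t|^{-ε}]` is at most the point `0`).
[folklore] -/
theorem collarMono_of_nonpos {ε C : ℝ} (hC : C ≤ 0) (T₂ : ℝ) :
    ∀ t : ℝ, T₂ ≤ |t| →
      MonotoneOn (fun x : ℝ => ‖riemannXi (1 / 2 + x + t * Complex.I)‖) (Set.Icc 0 (C * |t| ^ (-ε))) := by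
  intro t _ x hx y hy _
  have hC' : C * |t| ^ (-ε) ≤ 0 := mul_nonpos_of_nonpos_of_nonneg hC (Real.rpow_nonneg (abs_nonneg _) _)
  have hx0 : x = 0 := le_antisymm (le_trans hx.2 hC') hx.1
  have hy0 : y = 0 := le_antisymm (le_trans hy.2 hC') hy.1
  rw [hx0, hy0]


end Summit.RiemannHypothesis.Cruxes.CofiniteCriticalLine.Negative

end
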